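import Summits.QuantumFields.YangMills.Theorems.BalabanUVNodesN07ChartHInvTwisted
import Summits.QuantumFields.YangMills.Theorems.UnitScaleTiltProp8HalvingQuarterCubeSeq
import HarnessLib

/-!
# BalabanUVNodes ∕ N07 — [15] PROPOSITION 3 WITH (73)'s EXPONENTIAL DECAY AT NODE 00's RECORD, NO DISPLAYED OPERATOR HYPOTHESIS: the chart `D(·)` of the TRUE multi-level
# (0.4)-constraint on the route's right inverse `H` built on the canonical `flatH = GQ*(QGQ*)⁻¹`, with (73) at norm level AND in weight-conjugation form for EVERY twist
# compatible with the physical distance `distBI` of (161)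

Cell `pub-ymgap`, width seat `pub-ymgap-dag-n07-w2` generation 4 (HUMAN RULING D-0149; DAG node N07 = [15] = [Balaban1985Variational]; W-SEAT START LIST §n07 item 2 = S2
«Prop. 3 at objects» — the last printed clause, (73) with decay, CLOSED AT THE RECORD modulo the consumer's choice of twist).  `--kind proof --supports … --as helper`
(K1 face; count-neutral).  CONSUMED BY NAME, nothing modified: dag k0-s1-w3's d-generic port `K0FlatPortKernelRowsP.kernelRowsAt_of_adm22` ([Balaban1984PropagatorsII] Cor. 2.8
k-level rows on the tori `PV d ℓ m K`; NODE 00's `T4Family.P K = PV 3 ℓ m K` by `rfl`), `K0FlatCubeOpsTextP.{KernelRowsAt, flatH, isFlatH_flatH}`, the route's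
`HalvingQuarterCubeSeq.distBI_nonneg`, and this seat's `N07ChartHInvTwisted.exists_chartD_decay_of_kernelRows` (generation 3's selector + the twisted (73) + the twisted
letters of the corrected right inverse from the kernel row).

THE PRINT ([15] p. 289): «PROPOSITION 3. The transformation (47) … is defined and analytic for A′ satisfying (43) with ε₃ sufficiently small (e.g. 18C₂B₀dc₁(½)ε₃ ≤ 1,
2ε₃ ≤ c₄) … The function D(A′) satisfies the bound (55) and its functional derivative the bound (73)», (73) «|𝔇(A′; c, b)| ≤ O(1)C₃ε₃(Lʲη)^{−d+1}e^{−½δ₀d(c₋,y)}, b ∈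
Bʲ(y), y ∈ Λ_j».

WHAT IS PROVED (sorry-free; no definition; axioms standard).  §1 `kernelRowsAt_of_adm22_T4` — the `T4Family` edition of the port's kernel rows (as `K0FlatPortBodyP.body_of_adm22_T4`
does for `BodyAt`).  §2 ★★★★ `exists_chartD_decay_T4` — for every `F : T4Family`: thresholds `M_h⁰, R₀` and constants `C_K ≥ 0`, `δ₀ > 0`, `B₃ > 0` such that for every
admissible nested family `D` on `Site (F.P K) 0` of top level `K − n` (`Adm22 D R (L·L^{a′})`, `R ≥ R₀`, `2L ≤ R`, torus-size side conditions), every level-weight family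
`w` and every `ε` in the window `18C₂B₀′ε ≤ 1`, `64ε ≤ R⋆` (`B₀′ = C_KB₃(1+2C)(1+2C(1+L))`): ∃ `H` (right inverse of `D chartLog(0)`), `Dfun` (ℂ-differentiable on the weighted
`ε`-ball) with (55), (49), (48), `∃ 𝔇, HasFDerivAt` + the norm-level (73) `‖𝔇W i‖ ≤ 4C₃ε·t`, and for EVERY twist pair `dE∕dF` with rate `0 ≤ δ ≤ ½δ₀`, (s1) triangle
inequality against `distBI D`, (s2) index slack `r₁`, (s3) block slack `r₂`, (s4) read slack `r₀`, under `4C₃e^{δr₀}C_KB₃(1+2Ce^{δr₁})(1+2C(1+L)e^{δr₂})ε ≤ 1`: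
`e^{δ·dF(i)}‖𝔇W i‖ ≤ 4C₃e^{δr₀}ε·t` whenever `e^{δ·dE(b)}w₁(b)‖W b‖ ≤ t` — e.g. `dE`, `dF` = distances to a fixed block in any metric dominated by `distBI` through (s1).

HONEST FRAMING: count-neutral helper; composition of kernel theorems by name; the twist is the CONSUMER's (the four slacks are elementary geometry of `distBI` and the block
towers for «distance to a block», not typed here); the scalar prefactor `(Lʲη)^{−d+1}` of (73) is the weights' bookkeeping; (58) and [15] Sects. D–F NOT here; stub 1 ∕ K0⁷ ∕
K1⁸ NOT closed; N07 NOT discharged; counts unmoved; one finite T⁴ programme at fixed ε — NOT continuum ∕ ℝ⁴ ∕ OS ∕ mass gap ∕ Clay: the Yang–Mills mass gap is NOT proved by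
any of this; R4 closes the conditional rung `BalabanLadder.UV` only.  No `sorry`, no `def`, no `instance`, no `notation`.

References: [15] T. Bałaban, CMP 102 (1985) 277–309 [Balaban1985Variational] ((43)–(57) pp.285–287, (68)–(73) pp.288–289, Prop. 3 p.289, (161)–(162) p.303); [3] = [B6]
CMP 96 (1984) 223–250 [Balaban1984PropagatorsII] ((2.1)–(2.4) p.224, Lemma 2.1 p.232, Cor. 2.8 (2.150)–(2.151) p.249); [I] CMP 109 (1987) 249–301 [Balaban1987RG1]
((0.1) p.251, (0.4) p.253).
-/

noncomputable section

open scoped BigOperators Matrix.Norms.L2Operator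

namespace Summit.QuantumFields.YangMills.BalabanUVNodes.N07ChartDDecayAtRecord

open Literature.MathematicalPhysics.QuantumFieldTheory.Balaban1983to89
open Literature.MathematicalPhysics.QuantumFieldTheory.Balaban1983to89.T4Continuum (T4Family)
open B5Eq118OneStroke (iterBlockOf)
open B6SectADomainsV1 (Domains)
open B6SectAOperatorsV1 (BondIdx)
open Summit.QuantumFields.YangMills.Theorems.FlatCubeOpsText (Adm22 distBI)
open Summit.QuantumFields.YangMills.Theorems.K0FlatCubeOpsTextP (IsLevWeight KernelRowsAt HKernelRows RowSum162 flatH isFlatH_flatH hd4)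
open Summit.QuantumFields.YangMills.Theorems.K0FlatPortKernelRowsP (kernelRowsAt_of_adm22)
open Summit.QuantumFields.YangMills.Theorems.HalvingQuarterCubeSeq (distBI_nonneg)
open Summit.QuantumFields.YangMills.Theorems.Prop8Chart (chartLog)
open Summit.QuantumFields.YangMills.BalabanUVNodes.N07ChartHInvTwisted (exists_chartD_decay_of_kernelRows)

/-! ## §1 P2's kernel rows on NODE 00's four-tori (the `T4Family` edition of k0-s1-w3's `kernelRowsAt_of_adm22`, d = 4) -/

/-- **`KernelRowsAt` ON NODE 00's FOUR-TORI**: for every `F : T4Family` there are `M_h⁰, R₀ : ℕ` and `C ≥ 0`, `δ₀ > 0`, `B₃ > 0`, `C_G ≥ 0` such that for all heights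
`1 ≤ K − n`, `K − n + 1 ≤ F.m + K`, big blocks `M_h = L^{a′} ≥ M_h⁰`, `R ≥ R₀`, `a′ + 3 ≤ F.m + n`, every nested family `D : Domains (F.P K)` with `D.k = K − n` and
`Adm22 D R (L·M_h)`, and every level-weight family `w`: `KernelRowsAt (F.P K) (K − n) D w C δ₀ B₃ C_G` — a distance `dBI ≥ distBI` carrying (162) and the four kernel rows of
the canonical `flatH` (k0-s1-w3's d-generic `kernelRowsAt_of_adm22` at `d + 1 = 4`, the carrier identified by `rfl` as in `K0FlatPortBodyP.body_of_adm22_T4`).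
[cite: Balaban1984PropagatorsII, (2.1)-(2.4) p.224, Cor. 2.8 (2.150)-(2.151) p.249; Balaban1985Variational, (161)-(163) p.303; Balaban1987RG1, (0.1) p.251] -/
theorem kernelRowsAt_of_adm22_T4 (F : T4Family) :
    ∃ (Mh₀ R₀ : ℕ) (C δ₀ B₃ CG : ℝ), 0 ≤ C ∧ 0 < δ₀ ∧ 0 < B₃ ∧ 0 ≤ CG ∧
    ∀ (n K : ℕ) (_ : 1 ≤ K - n) (_ : K - n + 1 ≤ F.m + K) {Mh R a' : ℕ} (_ : Mh = F.L ^ a') (_ : Mh₀ ≤ Mh) (_ : R₀ ≤ R) (_ : a' + 3 ≤ F.m + n)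
      (D : Domains (F.P K)) (_ : D.k = K - n) (_ : Adm22 D R (F.L * Mh))
      (w : ℕ → PBond (F.P K) 0 → ℝ) (_ : IsLevWeight (F.P K) (K - n) D w),
      KernelRowsAt (F.P K) (K - n) D w C δ₀ B₃ CG := by
  obtain ⟨L, hL, h11, m, hm⟩ := F
  obtain ⟨ℓ, rfl⟩ : ∃ ℓ, L = ℓ + 1 := ⟨L - 1, by omega⟩
  have hℓ : 4 ≤ ℓ := by omega
  obtain ⟨Mh₀, R₀, C, δ₀, B₃, CG, hC, hδ₀, hB₃, hCG, hmain⟩ := kernelRowsAt_of_adm22 3 ℓ hd4 hL hℓ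
  refine ⟨Mh₀, R₀, C, δ₀, B₃, CG, hC, hδ₀, hB₃, hCG, ?_⟩
  intro n K hk1 hk' Mh R a' hMha hMh hR hsize D hDk hAdm w hw
  exact hmain m n K hk1 hk' hMha hMh hR hsize D hDk hAdm w hw

/-! ## §2 [15] Proposition 3 with (73)'s decay AT NODE 00's RECORD -/

/-- ★★★★ **[15] PROPOSITION 3 FOR THE TRUE MULTI-LEVEL (0.4)-CONSTRAINT AT NODE 00's RECORD, WITH (73) IN BOTH FORMS — the norm level AND the exponential decay for EVERY
admissible twist — NO displayed operator hypothesis.**  For every `F : T4Family` there are thresholds `M_h⁰, R₀` and constants `C_K ≥ 0`, `δ₀ > 0`, `B₃ > 0` (P2's kernel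
rows on the four-tori, §1) such that for all heights `1 ≤ K − n`, `K − n + 1 ≤ F.m + K`, big blocks `M_h = L^{a′} ≥ M_h⁰`, `R ≥ max R₀ 2L`, `a′ + 3 ≤ F.m + n`, every
nested family `D : Domains (F.P K)` with `D.k = K − n`, `Adm22 D R (L·M_h)`, every level-weight family `w`, and every `ε > 0` in the window `18C₂B₀′ε ≤ 1`, `64ε ≤ R⋆`
(`B₀′ = C_KB₃(1+2C)(1+2C(1+L))`, `C = (d+2)L`): THERE ARE the route's right inverse `H` of `D chartLog(0)` (built on the canonical `flatH = GQ*(QGQ*)⁻¹`) and generation 3's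
chart map `Dfun` with (55), (49), (48), a Fréchet derivative `𝔇`, the norm-level (73), and — for every twist pair `dE∕dF`, rate `0 ≤ δ ≤ ½δ₀`, with (s1) the triangle
inequality against the PHYSICAL distance `distBI D` of (161), (s2) index slack `r₁`, (s3) block slack `r₂`, (s4) read slack `r₀`, under `4C₃e^{δr₀}B_e(δ)ε ≤ 1` —
**`e^{δ·dF(i)}‖𝔇W i‖ ≤ 4C₃e^{δr₀}ε·t` whenever `e^{δ·dE(b)}w₁(b)‖W b‖ ≤ t`**.  Composition BY NAME: §1 + `N07ChartHInvTwisted.exists_chartD_decay_of_kernelRows` (the port's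
`dBI ≥ distBI` absorbed: (s1) against `distBI` implies (s1) against `dBI`). [cite: Balaban1985Variational, (45)-(57) pp.285-287, (68)-(73) pp.288-289, Prop. 3 p.289, (161)-(162) p.303; Balaban1984PropagatorsII, Lemma 2.1 p.232, Cor. 2.8 (2.150)-(2.151) p.249; Balaban1987RG1, (0.1) p.251, (0.4) p.253] -/
theorem exists_chartD_decay_T4 {ι : Type*} [Fintype ι] [DecidableEq ι] [Nonempty ι] (F : T4Family) :
    ∃ (Mh₀ R₀ : ℕ) (CK δ₀ B₃ : ℝ), 0 ≤ CK ∧ 0 < δ₀ ∧ 0 < B₃ ∧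
    ∀ (n K : ℕ) (_ : 1 ≤ K - n) (_ : K - n + 1 ≤ F.m + K) {Mh R a' : ℕ} (_ : Mh = F.L ^ a') (_ : Mh₀ ≤ Mh) (_ : R₀ ≤ R) (_ : 2 * F.L ≤ R)
      (_ : a' + 3 ≤ F.m + n) (D : Domains (F.P K)) (_ : D.k = K - n) (_ : Adm22 D R (F.L * Mh))
      (w : ℕ → PBond (F.P K) 0 → ℝ) (_ : IsLevWeight (F.P K) (K - n) D w) {ε : ℝ} (_ : 0 < ε)
      (_ : 18 * (960 * ((((F.P K).d + 2) * (F.P K).L : ℕ) : ℝ) * ((F.P K).L : ℝ) / (12800 * ((((F.P K).d + 2) * (F.P K).L : ℕ) : ℝ) ^ 2 * ((F.P K).L : ℝ))⁻¹) *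
        (CK * B₃ * (1 + 2 * (((F.P K).d + 2) * (F.P K).L : ℕ)) * (1 + 2 * (((F.P K).d + 2) * (F.P K).L : ℕ) * (1 + (F.P K).L))) * ε ≤ 1)
      (_ : 64 * ε ≤ (12800 * ((((F.P K).d + 2) * (F.P K).L : ℕ) : ℝ) ^ 2 * ((F.P K).L : ℝ))⁻¹),
      let η : ℝ := (((F.P K).L : ℝ)⁻¹) ^ (K - n)
      let Rs : ℝ := (12800 * ((((F.P K).d + 2) * (F.P K).L : ℕ) : ℝ) ^ 2 * ((F.P K).L : ℝ))⁻¹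
      let C₂ : ℝ := 960 * ((((F.P K).d + 2) * (F.P K).L : ℕ) : ℝ) * ((F.P K).L : ℝ) / Rs
      let C₃ : ℝ := 3840 * ((((F.P K).d + 2) * (F.P K).L : ℕ) : ℝ) * ((F.P K).L : ℝ) / Rs
      let Qlin := (fderiv ℂ (chartLog η D : (PBond (F.P K) 0 → Matrix ι ι ℂ) → BondIdx D → Matrix ι ι ℂ) 0)
      ∃ (H : (BondIdx D → Matrix ι ι ℂ) →ₗ[ℂ] (PBond (F.P K) 0 → Matrix ι ι ℂ)) (Dfun : (PBond (F.P K) 0 → Matrix ι ι ℂ) → (BondIdx D → Matrix ι ι ℂ)),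
        (∀ X, Qlin (H X) = X) ∧
        DifferentiableOn ℂ Dfun {A' : PBond (F.P K) 0 → Matrix ι ι ℂ | ∀ b, w 1 b * ‖A' b‖ < ε} ∧
        ∀ A' : PBond (F.P K) 0 → Matrix ι ι ℂ, (∀ b, w 1 b * ‖A' b‖ < ε) →
          (∀ (ρ : ℝ), 0 ≤ ρ → (∀ b, w 1 b * ‖A' b‖ ≤ ρ) → ∀ i, ‖Dfun A' i‖ ≤ 4 * C₂ * ρ ^ 2) ∧
          chartLog η D (A' - H (Dfun A')) - Qlin (A' - H (Dfun A')) = Dfun A' ∧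
          chartLog η D (A' - H (Dfun A')) = Qlin A' ∧
          ∃ 𝔇 : (PBond (F.P K) 0 → Matrix ι ι ℂ) →L[ℂ] (BondIdx D → Matrix ι ι ℂ), HasFDerivAt Dfun 𝔇 A' ∧
            (∀ (W : PBond (F.P K) 0 → Matrix ι ι ℂ) (t : ℝ), 0 ≤ t → (∀ b, w 1 b * ‖W b‖ ≤ t) → ∀ i, ‖𝔇 W i‖ ≤ 4 * C₃ * ε * t) ∧
            ∀ (dE : PBond (F.P K) 0 → ℝ) (dF : BondIdx D → ℝ) (δ r₀ r₁ r₂ : ℝ), 0 ≤ δ → δ ≤ δ₀ / 2 →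
              (∀ b c, dE b ≤ distBI D b c + dF c) →
              (∀ (i c : BondIdx D) (x : Site (F.P K) 0),
                (iterBlockOf (i.1.1 : ℕ) x = i.1.2.src ∨ iterBlockOf (i.1.1 : ℕ) x = i.1.2.tgt) →
                (iterBlockOf (c.1.1 : ℕ) x = c.1.2.src ∨ iterBlockOf (c.1.1 : ℕ) x = c.1.2.tgt) → dF i ≤ dF c + r₁) →
              (∀ (b b' : PBond (F.P K) 0) (x : Site (F.P K) 0) (j : ℕ), (x = b.src ∨ x = b.tgt) → j ≤ D.k →
                iterBlockOf j b'.src = iterBlockOf j x → dE b ≤ dE b' + r₂) →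
              (∀ (idx : BondIdx D) (b : PBond (F.P K) 0),
                (iterBlockOf (idx.1.1 : ℕ) b.src = idx.1.2.src ∨ iterBlockOf (idx.1.1 : ℕ) b.src = idx.1.2.tgt) →
                (iterBlockOf (idx.1.1 : ℕ) b.tgt = idx.1.2.src ∨ iterBlockOf (idx.1.1 : ℕ) b.tgt = idx.1.2.tgt) → dF idx ≤ dE b + r₀) →
              4 * C₃ * Real.exp (δ * r₀) *
                  (CK * B₃ * (1 + 2 * (((F.P K).d + 2) * (F.P K).L : ℕ) * Real.exp (δ * r₁)) *
                    (1 + 2 * (((F.P K).d + 2) * (F.P K).L : ℕ) * (1 + (F.P K).L) * Real.exp (δ * r₂))) * ε ≤ 1 →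
              ∀ (W : PBond (F.P K) 0 → Matrix ι ι ℂ) (t : ℝ), 0 ≤ t → (∀ b, Real.exp (δ * dE b) * (w 1 b * ‖W b‖) ≤ t) →
                ∀ i, Real.exp (δ * dF i) * ‖𝔇 W i‖ ≤ 4 * C₃ * Real.exp (δ * r₀) * ε * t := by
  obtain ⟨Mh₀, R₀, CK, δ₀, B₃, CG, hCK, hδ₀, hB₃, -, hmain⟩ := kernelRowsAt_of_adm22_T4 F
  refine ⟨Mh₀, R₀, CK, δ₀, B₃, hCK, hδ₀, hB₃, ?_⟩
  intro n K hk1 hk' Mh R a' hMha hMh hR h2L hsize D hDk hAdm w hw ε hε h18 h2 η Rs C₂ C₃ Qlin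
  -- P2's rows at this family: a distance `dBI ≥ distBI` with (162) and the kernel rows of `flatH`
  obtain ⟨⟨dBI, hdist, h162, hker⟩, -⟩ := hmain n K hk1 hk' hMha hMh hR hsize D hDk hAdm w hw
  have hd0 : ∀ b c, 0 ≤ dBI b c := fun b c => (distBI_nonneg D b c).trans (hdist b c)
  have hL1 : 1 ≤ F.L := by have := F.hL11; omega
  have hM : 1 ≤ F.L * Mh := by
    rw [hMha]; exact Nat.one_le_iff_ne_zero.mpr (Nat.mul_ne_zero (by omega) (pow_ne_zero _ (by omega)))
  obtain ⟨H, Dfun, hHinv, hdiff, hDfun⟩ := exists_chartD_decay_of_kernelRows (n := ι) (K - n) h2L hM D hDk hAdm hw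
    (flatH (F.P K) (K - n) D) (isFlatH_flatH (F.P K) (K - n) D) dBI hd0 hCK hδ₀.le hB₃.le hker h162 hε h18 h2
  refine ⟨H, Dfun, hHinv, hdiff, fun A' hA' => ?_⟩
  obtain ⟨h55, h49, h48, 𝔇, h𝔇, h73, htw⟩ := hDfun A' hA'
  refine ⟨h55, h49, h48, 𝔇, h𝔇, h73, fun dE dF δ r₀ r₁ r₂ hδ hδh htri hF hE hread hsmall W t ht hW i => ?_⟩
  exact htw dE dF δ r₀ r₁ r₂ hδ hδh (fun b c => (htri b c).trans (by linarith [hdist b c])) hF hE hread hsmall W t ht hW i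

end Summit.QuantumFields.YangMills.BalabanUVNodes.N07ChartDDecayAtRecord

end
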